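import Summits.ResolutionOfSingularities.ResolutionOfSingularities.Theorems.FrobeniusLadderFInjectiveMacaulayficationOmegaOneFloorInput
import Summits.ResolutionOfSingularities.ResolutionOfSingularities.Theorems.FrobeniusLadderFInjectiveMacaulayficationHypersurfaceRegular
import HarnessLib

/-!
# BED Ω cusp-pencil floors `𝒥_e = (c^e, a² − b³)` on `k[a,b,c,d]`, EVERY `e ≥ 7`: the input column of ✓ `OmegaOneFloorInput` (`e = 22`, `Γ₉`) made GENERIC in the boundary
# exponent — so that `Γ₁₀` (`e = 43`) and every later member of the family is ONE instantiation: deep memberships for every prime, NOT FULL on all of `ℙ¹_Q`, both charts CM and INTEGRAL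
# (crux `FInjectiveMacaulayfication` stmt-ResolutionOfSingularities-15315, chain w45a; res-L1-w45a-plan-1 R23.2 (3) (α) family form; seat res-L1-w45a-stub-3 g12; engine ✓ p689316
# `PencilFedder` (res-L1-w45a-stub-1), transport ✓ `OmegaOneFloorInput.affinePencilChart_isPrime_last`)

[OURS · L1 W4.5a] Support file (`--supports stmt-ResolutionOfSingularities-15315 --as helper`); def-free; unconditional; no named fact; NOT a statement of any manuscript; nothing of the
crux is proved. AI-written (AI review is weaker than expert review).

* §1 ★ `deep_mem (e) (he : 7 ≤ e) (p) (hp : 2 ≤ p) (j ≤ p−1)` — `(c^e)^j·(a² − b³)^{p−1−j} ∈ (a^p, b^p, c^p, d^p)`: the term `c^{ej} a^{2m} b^{3(p−1−j−m)}` has `ej ≥ p`, or `2m ≥ p`, or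
  `3(p−1−j−m) ≥ p` (the last because `ej ≤ p−1` with `e ≥ 7` forces `6j < p − 1`). The bound `e ≥ 7` is what the arithmetic uses; for `e = 1` the statement is false (`j = p−1`).
* §2 `pencilChart_not_full_at (e) (w₀)` / `pencilChart_not_full_infty (e)` — NOT `FullCl p` at every `k`-point of `ℙ¹_Q`, every prime `p = char k`.
* §3 `hreg_W (e)` / `hreg_U (e)`, ★ `isPrime_wChart (e) (w₀)` / `isPrime_uChart (e)` — both charts INTEGRAL (every `e ≥ 1`); `cmCl_stalk_wChart (e)` / `cmCl_stalk_uChart (e)` — CM clause (every `e`).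
* §4 the `Γ₁₀` instances (`e = 43`): `gamma10_not_full_at`, `gamma10_not_full_infty`.
* §L4 (APPENDED) `regular_wChart_of_not_mem` / `regular_uChart_of_not_mem` — (L4) of res-L1-w45a-plan-1 R23.9: both charts are REGULAR at every prime not containing `c`
  (Jacobian criterion: `∂_W = c^e`, `∂_U = B`; ✓ `HypersurfaceRegular.stub_hypersurfaceRegularOfPderiv`).
[cite: Fedder1983, Prop. 1.7 and Thm. 1.12] [cite: Matsumura1987, Thm. 30.3 (context)] [folklore]
-/

-- single-problem summit: the doubled namespace component is forced
set_option linter.dupNamespace false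

noncomputable section

open CategoryTheory AlgebraicGeometry TopologicalSpace IsLocalRing MvPolynomial
open Literature.AlgebraicGeometry.Resolution

namespace Summit.ResolutionOfSingularities.ResolutionOfSingularities.Theorems.FInjectiveMacaulayfication.OmegaCuspPencilInput

open Summit.ResolutionOfSingularities.ResolutionOfSingularities.Theorems.FInjectiveMacaulayfication
open SliceableCentre OmegaOneFloorInput

/-! ## §1 ★ The deep memberships for every `e ≥ 7` and every `p ≥ 2` -/

/-- ★ **`(c^e)^j · (a² − b³)^{p−1−j} ∈ (a^p, b^p, c^p, d^p)`** for all `j ≤ p − 1`, every `p ≥ 2`, every `e ≥ 7`. [OURS · p-uniform certificate; cite: Fedder1983, Prop. 1.7 (context)] -/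
theorem deep_mem (k : Type) [Field k] (e : ℕ) (he : 7 ≤ e) (p : ℕ) (hp : 2 ≤ p) (j : ℕ) (_hj : j ≤ p - 1) :
    ((X 2 : MvPolynomial (Fin 4) k) ^ e) ^ j * (X 0 ^ 2 - X 1 ^ 3) ^ (p - 1 - j) ∈
      Ideal.span (Set.range fun i : Fin 4 => (X i : MvPolynomial (Fin 4) k) ^ p) := by
  set I : Ideal (MvPolynomial (Fin 4) k) := Ideal.span (Set.range fun i : Fin 4 => (X i : MvPolynomial (Fin 4) k) ^ p) with hI
  have ha : (X 0 : MvPolynomial (Fin 4) k) ^ p ∈ I := Ideal.subset_span ⟨0, rfl⟩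
  have hb : (X 1 : MvPolynomial (Fin 4) k) ^ p ∈ I := Ideal.subset_span ⟨1, rfl⟩
  have hc : (X 2 : MvPolynomial (Fin 4) k) ^ p ∈ I := Ideal.subset_span ⟨2, rfl⟩
  by_cases hcj : p ≤ e * j
  · have e1 : (((X 2 : MvPolynomial (Fin 4) k) ^ e) ^ j) = X 2 ^ p * X 2 ^ (e * j - p) := by
      rw [← pow_mul, ← pow_add]; congr 1; omega
    rw [e1, mul_assoc]
    exact Ideal.mul_mem_right _ _ hc
  · have hcj' : e * j ≤ p - 1 := by omega
    have h6 : 6 * j < e * j ∨ j = 0 := by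
      rcases Nat.eq_zero_or_pos j with h0 | hpos
      · exact Or.inr h0
      · exact Or.inl (Nat.mul_lt_mul_of_pos_right (by omega) hpos)
    rw [sub_eq_add_neg, add_pow, Finset.mul_sum]
    refine Ideal.sum_mem _ fun m hm => ?_
    rw [Finset.mem_range] at hm
    by_cases h2m : p ≤ 2 * m
    · have e2 : (((X 0 : MvPolynomial (Fin 4) k) ^ 2) ^ m) = X 0 ^ p * X 0 ^ (2 * m - p) := by
        rw [← pow_mul, ← pow_add]; congr 1; omega
      rw [e2]
      exact Ideal.mul_mem_left _ _ (Ideal.mul_mem_right _ _ (Ideal.mul_mem_right _ _ (Ideal.mul_mem_right _ _ ha)))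
    · have h3 : p ≤ 3 * (p - 1 - j - m) := by
        rcases h6 with h6 | h0
        · omega
        · subst h0; omega
      have e3 : (-((X 1 : MvPolynomial (Fin 4) k) ^ 3)) ^ (p - 1 - j - m) = (-1) ^ (p - 1 - j - m) * (X 1 ^ p * X 1 ^ (3 * (p - 1 - j - m) - p)) := by
        rw [neg_pow, ← pow_mul, ← pow_add]; congr 2; omega
      rw [e3]
      exact Ideal.mul_mem_left _ _ (Ideal.mul_mem_right _ _ (Ideal.mul_mem_left _ _ (Ideal.mul_mem_left _ _ (Ideal.mul_mem_right _ _ hb))))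

/-- `c^e ≠ 0`. [plumbing] -/
theorem M_ne_zero (k : Type) [Field k] (e : ℕ) : ((X 2 : MvPolynomial (Fin 4) k) ^ e) ≠ 0 := pow_ne_zero _ (X_ne_zero _)

/-- `(c^e)(0) = 0` for `e ≥ 1`. [plumbing] -/
theorem constantCoeff_M (k : Type) [Field k] (e : ℕ) (he : 1 ≤ e) : constantCoeff (((X 2 : MvPolynomial (Fin 4) k) ^ e)) = 0 := by
  rw [map_pow, constantCoeff_X, zero_pow (by omega)]

/-! ## §2 NOT FULL at every `k`-point of `ℙ¹_Q`, every prime, every `e ≥ 7` -/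

/-- ★★ **THE `W`-CHART POINTS** of `Bl_{(c^e, a² − b³)} 𝔸⁴` over `Q` are NOT `FullCl p` (`e ≥ 7`, every prime `p = char k`, every `w₀`). [OURS · certificate instance;
cite: Fedder1983, Thm. 1.12] -/
theorem pencilChart_not_full_at (k : Type) [Field k] (e : ℕ) (he : 7 ≤ e) (p : ℕ) [Fact p.Prime] [CharP k p] (w₀ : k) (G : MvPolynomial (Fin 5) k)
    (hG : G = rename (Fin.castSucc : Fin 4 → Fin 5) ((X 2 : MvPolynomial (Fin 4) k) ^ e) * (X (Fin.last 4) + C w₀) -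
      rename (Fin.castSucc : Fin 4 → Fin 5) (X 0 ^ 2 - X 1 ^ 3 : MvPolynomial (Fin 4) k))
    (v : Spec (.of (MvPolynomial (Fin 5) k ⧸ Ideal.span {G})))
    (hv : v.asIdeal = Ideal.span (Set.range fun j : Fin 5 => Ideal.Quotient.mk (Ideal.span {G}) (X j))) :
    ¬ FullCl p ((Spec (.of (MvPolynomial (Fin 5) k ⧸ Ideal.span {G}))).presheaf.stalk v) :=
  PencilFedder.pencilChart_not_full_at k p _ _ (M_ne_zero k e) (constantCoeff_M k e (by omega)) (constantCoeff_B k)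
    (fun j hj => deep_mem k e he p (Fact.out : p.Prime).two_le j hj) w₀ G hG v hv

/-- ★★ **THE POINT `W = ∞`** of `Bl_{(c^e, a² − b³)} 𝔸⁴` over `Q` is NOT `FullCl p` (`e ≥ 7`, every prime). [OURS · certificate instance; cite: Fedder1983, Thm. 1.12] -/
theorem pencilChart_not_full_infty (k : Type) [Field k] (e : ℕ) (he : 7 ≤ e) (p : ℕ) [Fact p.Prime] [CharP k p] (G : MvPolynomial (Fin 5) k)
    (hG : G = rename (Fin.castSucc : Fin 4 → Fin 5) (X 0 ^ 2 - X 1 ^ 3 : MvPolynomial (Fin 4) k) * X (Fin.last 4) -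
      rename (Fin.castSucc : Fin 4 → Fin 5) ((X 2 : MvPolynomial (Fin 4) k) ^ e))
    (v : Spec (.of (MvPolynomial (Fin 5) k ⧸ Ideal.span {G})))
    (hv : v.asIdeal = Ideal.span (Set.range fun j : Fin 5 => Ideal.Quotient.mk (Ideal.span {G}) (X j))) :
    ¬ FullCl p ((Spec (.of (MvPolynomial (Fin 5) k ⧸ Ideal.span {G}))).presheaf.stalk v) :=
  PencilFedder.pencilChart_not_full_infty k p _ _ (M_ne_zero k e) (constantCoeff_M k e (by omega))
    (fun j hj => deep_mem k e he p (Fact.out : p.Prime).two_le j hj) G hG v hv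

/-! ## §3 Integrality and the CM clause of both charts, every `e ≥ 1` -/

/-- `a² − b³` is regular modulo `c^e`. [elementary] -/
theorem hreg_W (k : Type) [Field k] (e : ℕ) (t : MvPolynomial (Fin 4) k)
    (ht : (X 0 ^ 2 - X 1 ^ 3 : MvPolynomial (Fin 4) k) * t ∈ Ideal.span {((X 2 : MvPolynomial (Fin 4) k) ^ e)}) :
    t ∈ Ideal.span {((X 2 : MvPolynomial (Fin 4) k) ^ e)} := by
  rw [Ideal.mem_span_singleton] at ht ⊢
  exact (MvPolynomial.X_prime (i := (2 : Fin 4))).pow_dvd_of_dvd_mul_left e (not_X_dvd_B k) ht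

/-- `c^e` is regular modulo `a² − b³`. [elementary] -/
theorem hreg_U (k : Type) [Field k] (e : ℕ) (t : MvPolynomial (Fin 4) k)
    (ht : ((X 2 : MvPolynomial (Fin 4) k) ^ e) * t ∈ Ideal.span {(X 0 ^ 2 - X 1 ^ 3 : MvPolynomial (Fin 4) k)}) :
    t ∈ Ideal.span {(X 0 ^ 2 - X 1 ^ 3 : MvPolynomial (Fin 4) k)} := by
  rw [Ideal.mem_span_singleton] at ht ⊢
  rcases (prime_B k).dvd_or_dvd ht with h | h
  · exact absurd ((prime_B k).dvd_of_dvd_pow h) (not_B_dvd_X k)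
  · exact h

/-- ★ The `W`-chart `(c^e·(W + w₀) − (a² − b³))` is PRIME, every `e`, every `w₀`. [OURS · certificate instance] -/
theorem isPrime_wChart (k : Type) [Field k] (e : ℕ) (w₀ : k) (G : MvPolynomial (Fin 5) k)
    (hG : G = rename (Fin.castSucc : Fin 4 → Fin 5) ((X 2 : MvPolynomial (Fin 4) k) ^ e) * (X (Fin.last 4) + C w₀) -
      rename (Fin.castSucc : Fin 4 → Fin 5) (X 0 ^ 2 - X 1 ^ 3 : MvPolynomial (Fin 4) k)) :
    (Ideal.span {G}).IsPrime := by
  have key : G = rename (Fin.castSucc : Fin 4 → Fin 5) ((X 2 : MvPolynomial (Fin 4) k) ^ e) * X (Fin.last 4) -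
      rename (Fin.castSucc : Fin 4 → Fin 5) (X 0 ^ 2 - X 1 ^ 3 - C w₀ * X 2 ^ e : MvPolynomial (Fin 4) k) := by
    rw [hG]
    simp only [map_sub, map_mul, map_pow, rename_X, rename_C]
    ring
  rw [key]
  refine affinePencilChart_isPrime_last k _ _ (M_ne_zero k e) (fun t ht => hreg_W k e t ?_)
  have hsplit : (X 0 ^ 2 - X 1 ^ 3 : MvPolynomial (Fin 4) k) * t = (X 0 ^ 2 - X 1 ^ 3 - C w₀ * X 2 ^ e) * t + C w₀ * t * X 2 ^ e := by ring
  rw [hsplit]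
  exact Ideal.add_mem _ ht (Ideal.mul_mem_left _ _ (Ideal.mem_span_singleton_self _))

/-- ★ The `U`-chart `((a² − b³)·U − c^e)` is PRIME, every `e`. [OURS · certificate instance] -/
theorem isPrime_uChart (k : Type) [Field k] (e : ℕ) (G : MvPolynomial (Fin 5) k)
    (hG : G = rename (Fin.castSucc : Fin 4 → Fin 5) (X 0 ^ 2 - X 1 ^ 3 : MvPolynomial (Fin 4) k) * X (Fin.last 4) -
      rename (Fin.castSucc : Fin 4 → Fin 5) ((X 2 : MvPolynomial (Fin 4) k) ^ e)) :
    (Ideal.span {G}).IsPrime := by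
  rw [hG]
  exact affinePencilChart_isPrime_last k _ _ (B_ne_zero k) (hreg_U k e)

/-- The `W`-chart polynomial is non-zero (`∂_W G = c^e ≠ 0`; res-L1-w45a-stub-1ʼs argument). [plumbing] -/
theorem wChart_ne_zero (k : Type) [Field k] (e : ℕ) (w₀ : k) (G : MvPolynomial (Fin 5) k)
    (hG : G = rename (Fin.castSucc : Fin 4 → Fin 5) ((X 2 : MvPolynomial (Fin 4) k) ^ e) * (X (Fin.last 4) + C w₀) -
      rename (Fin.castSucc : Fin 4 → Fin 5) (X 0 ^ 2 - X 1 ^ 3 : MvPolynomial (Fin 4) k)) : G ≠ 0 := by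
  intro h0
  have hd : pderiv (Fin.last 4) G = rename (Fin.castSucc : Fin 4 → Fin 5) ((X 2 : MvPolynomial (Fin 4) k) ^ e) := by
    rw [hG, map_sub, Derivation.leibniz, PencilFedder.pderiv_last_rename_castSucc k, PencilFedder.pderiv_last_rename_castSucc k, map_add,
      pderiv_X_self, pderiv_C]
    simp
  rw [h0, map_zero] at hd
  exact M_ne_zero k e (rename_injective _ (Fin.castSucc_injective _) (by rw [map_zero]; exact hd.symm))

/-- The `U`-chart polynomial is non-zero (set `U = 0`: `G ↦ −c^e ≠ 0`; res-L1-w45a-stub-1ʼs argument). [plumbing] -/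
theorem uChart_ne_zero (k : Type) [Field k] (e : ℕ) (G : MvPolynomial (Fin 5) k)
    (hG : G = rename (Fin.castSucc : Fin 4 → Fin 5) (X 0 ^ 2 - X 1 ^ 3 : MvPolynomial (Fin 4) k) * X (Fin.last 4) -
      rename (Fin.castSucc : Fin 4 → Fin 5) ((X 2 : MvPolynomial (Fin 4) k) ^ e)) : G ≠ 0 := by
  intro h0
  have h := congrArg (MvPolynomial.aeval (fun j : Fin 5 => if j = Fin.last 4 then (0 : MvPolynomial (Fin 5) k) else X j)) h0
  rw [hG, map_sub, map_mul, aeval_X, if_pos rfl, mul_zero, zero_sub, map_zero, neg_eq_zero, aeval_rename] at h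
  have hid : ((fun j : Fin 5 => if j = Fin.last 4 then (0 : MvPolynomial (Fin 5) k) else X j) ∘ Fin.castSucc) = X ∘ Fin.castSucc :=
    funext fun j => by simp only [Function.comp_apply]; rw [if_neg (Fin.castSucc_lt_last j).ne]
  rw [hid, ← aeval_rename, aeval_X_left_apply] at h
  exact M_ne_zero k e (rename_injective _ (Fin.castSucc_injective _) (by rw [h, map_zero]))

/-- The `W`-chart satisfies the CM clause at every stalk. [tree assembly] -/
theorem cmCl_stalk_wChart (k : Type) [Field k] (e : ℕ) (w₀ : k) (G : MvPolynomial (Fin 5) k)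
    (hG : G = rename (Fin.castSucc : Fin 4 → Fin 5) ((X 2 : MvPolynomial (Fin 4) k) ^ e) * (X (Fin.last 4) + C w₀) -
      rename (Fin.castSucc : Fin 4 → Fin 5) (X 0 ^ 2 - X 1 ^ 3 : MvPolynomial (Fin 4) k))
    (y : Spec (.of (MvPolynomial (Fin 5) k ⧸ Ideal.span {G}))) :
    CMCl ((Spec (.of (MvPolynomial (Fin 5) k ⧸ Ideal.span {G}))).presheaf.stalk y) :=
  GermOfGlobalBlowup.cmCl_stalk_Spec_of_cmCl_localization y (DoublePointFermatCubicGerm.cmCl_localization_hypersurface k G (wChart_ne_zero k e w₀ G hG) y)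

/-- The `U`-chart satisfies the CM clause at every stalk. [tree assembly] -/
theorem cmCl_stalk_uChart (k : Type) [Field k] (e : ℕ) (G : MvPolynomial (Fin 5) k)
    (hG : G = rename (Fin.castSucc : Fin 4 → Fin 5) (X 0 ^ 2 - X 1 ^ 3 : MvPolynomial (Fin 4) k) * X (Fin.last 4) -
      rename (Fin.castSucc : Fin 4 → Fin 5) ((X 2 : MvPolynomial (Fin 4) k) ^ e))
    (y : Spec (.of (MvPolynomial (Fin 5) k ⧸ Ideal.span {G}))) :
    CMCl ((Spec (.of (MvPolynomial (Fin 5) k ⧸ Ideal.span {G}))).presheaf.stalk y) :=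
  GermOfGlobalBlowup.cmCl_stalk_Spec_of_cmCl_localization y (DoublePointFermatCubicGerm.cmCl_localization_hypersurface k G (uChart_ne_zero k e G hG) y)

/-! ## §4 The `Γ₁₀` instances (`e = 43`) -/

/-- ★ **`Γ₁₀`ʼS LOCAL MODEL `(c⁴³, u′² − y′³)`: the `W`-chart points over `Q` are NOT `FullCl p`**, every prime, every `w₀`. [OURS · certificate instance; cite: Fedder1983, Thm. 1.12] -/
theorem gamma10_not_full_at (k : Type) [Field k] (p : ℕ) [Fact p.Prime] [CharP k p] (w₀ : k) (G : MvPolynomial (Fin 5) k)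
    (hG : G = rename (Fin.castSucc : Fin 4 → Fin 5) ((X 2 : MvPolynomial (Fin 4) k) ^ 43) * (X (Fin.last 4) + C w₀) -
      rename (Fin.castSucc : Fin 4 → Fin 5) (X 0 ^ 2 - X 1 ^ 3 : MvPolynomial (Fin 4) k))
    (v : Spec (.of (MvPolynomial (Fin 5) k ⧸ Ideal.span {G})))
    (hv : v.asIdeal = Ideal.span (Set.range fun j : Fin 5 => Ideal.Quotient.mk (Ideal.span {G}) (X j))) :
    ¬ FullCl p ((Spec (.of (MvPolynomial (Fin 5) k ⧸ Ideal.span {G}))).presheaf.stalk v) :=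
  pencilChart_not_full_at k 43 (by norm_num) p w₀ G hG v hv

/-- ★ **`Γ₁₀`: the point `W = ∞` over `Q` is NOT `FullCl p`**, every prime. [OURS · certificate instance; cite: Fedder1983, Thm. 1.12] -/
theorem gamma10_not_full_infty (k : Type) [Field k] (p : ℕ) [Fact p.Prime] [CharP k p] (G : MvPolynomial (Fin 5) k)
    (hG : G = rename (Fin.castSucc : Fin 4 → Fin 5) (X 0 ^ 2 - X 1 ^ 3 : MvPolynomial (Fin 4) k) * X (Fin.last 4) -
      rename (Fin.castSucc : Fin 4 → Fin 5) ((X 2 : MvPolynomial (Fin 4) k) ^ 43))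
    (v : Spec (.of (MvPolynomial (Fin 5) k ⧸ Ideal.span {G})))
    (hv : v.asIdeal = Ideal.span (Set.range fun j : Fin 5 => Ideal.Quotient.mk (Ideal.span {G}) (X j))) :
    ¬ FullCl p ((Spec (.of (MvPolynomial (Fin 5) k ⧸ Ideal.span {G}))).presheaf.stalk v) :=
  pencilChart_not_full_infty k 43 (by norm_num) p G hG v hv

/-! ## §L4 Regularity over `{c ≠ 0}` — the legality clause (L4) of res-L1-w45a-plan-1 R23.9 («S′ regular off g⁻¹(v) ⊇ π⁻¹(E)», in the local model: regular over `{c ≠ 0}`) -/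

/-- The renamed boundary power, spelled out in `k[X₀..X₄]`. [plumbing] -/
theorem rename_Me (k : Type) [Field k] (e : ℕ) : rename (Fin.castSucc : Fin 4 → Fin 5) ((X 2 : MvPolynomial (Fin 4) k) ^ e) = X 2 ^ e := by
  rw [map_pow, rename_X]; rfl

/-- `∂_W` of the `W`-chart polynomial is `c^e`. [plumbing] -/
theorem pderiv_last_wChart (k : Type) [Field k] (e : ℕ) (w₀ : k) (G : MvPolynomial (Fin 5) k)
    (hG : G = rename (Fin.castSucc : Fin 4 → Fin 5) ((X 2 : MvPolynomial (Fin 4) k) ^ e) * (X (Fin.last 4) + C w₀) -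
      rename (Fin.castSucc : Fin 4 → Fin 5) (X 0 ^ 2 - X 1 ^ 3 : MvPolynomial (Fin 4) k)) :
    pderiv (Fin.last 4) G = X 2 ^ e := by
  rw [hG, map_sub, Derivation.leibniz, PencilFedder.pderiv_last_rename_castSucc k, PencilFedder.pderiv_last_rename_castSucc k, map_add,
    pderiv_X_self, pderiv_C, rename_Me]
  simp

/-- `∂_U` of the `U`-chart polynomial is `B`. [plumbing] -/
theorem pderiv_last_uChart (k : Type) [Field k] (e : ℕ) (G : MvPolynomial (Fin 5) k)
    (hG : G = rename (Fin.castSucc : Fin 4 → Fin 5) (X 0 ^ 2 - X 1 ^ 3 : MvPolynomial (Fin 4) k) * X (Fin.last 4) -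
      rename (Fin.castSucc : Fin 4 → Fin 5) ((X 2 : MvPolynomial (Fin 4) k) ^ e)) :
    pderiv (Fin.last 4) G = rename (Fin.castSucc : Fin 4 → Fin 5) (X 0 ^ 2 - X 1 ^ 3 : MvPolynomial (Fin 4) k) := by
  rw [hG, map_sub, Derivation.leibniz, pderiv_X_self, PencilFedder.pderiv_last_rename_castSucc k, PencilFedder.pderiv_last_rename_castSucc k]
  simp

/-- ★ (L4) **THE `W`-CHART IS REGULAR AT EVERY POINT WITH `c ≠ 0`** (Jacobian criterion: `∂_W G = c^e` is a unit there), every `e`, every `w₀`. [OURS · certificate instance;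
cite: Matsumura1987, Thm. 30.3 (context: Jacobian criterion), via ✓ `HypersurfaceRegular.stub_hypersurfaceRegularOfPderiv`] -/
theorem regular_wChart_of_not_mem (k : Type) [Field k] (e : ℕ) (w₀ : k) (G : MvPolynomial (Fin 5) k)
    (hG : G = rename (Fin.castSucc : Fin 4 → Fin 5) ((X 2 : MvPolynomial (Fin 4) k) ^ e) * (X (Fin.last 4) + C w₀) -
      rename (Fin.castSucc : Fin 4 → Fin 5) (X 0 ^ 2 - X 1 ^ 3 : MvPolynomial (Fin 4) k))
    (Q : Ideal (MvPolynomial (Fin 5) k ⧸ Ideal.span {G})) [Q.IsPrime] (hc : Ideal.Quotient.mk (Ideal.span {G}) (X 2) ∉ Q) :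
    IsRegularLocalRing (Localization.AtPrime Q) := by
  have hP : (Q.comap (Ideal.Quotient.mk (Ideal.span {G}))).IsPrime := Ideal.comap_isPrime _ _
  refine HypersurfaceRegular.stub_hypersurfaceRegularOfPderiv k 5 G (Fin.last 4) Q ?_
  rw [pderiv_last_wChart k e w₀ G hG]
  exact fun h => hc (Ideal.mem_comap.mp (hP.mem_of_pow_mem e h))

/-- ★ (L4) **THE `U`-CHART IS REGULAR AT EVERY POINT WITH `c ≠ 0`** (`∂_U G = B`, and `B ∈ Q` would force `c^e = B·U − G ∈ Q`). [OURS · certificate instance; cite: Matsumura1987,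
Thm. 30.3 (context)] -/
theorem regular_uChart_of_not_mem (k : Type) [Field k] (e : ℕ) (G : MvPolynomial (Fin 5) k)
    (hG : G = rename (Fin.castSucc : Fin 4 → Fin 5) (X 0 ^ 2 - X 1 ^ 3 : MvPolynomial (Fin 4) k) * X (Fin.last 4) -
      rename (Fin.castSucc : Fin 4 → Fin 5) ((X 2 : MvPolynomial (Fin 4) k) ^ e))
    (Q : Ideal (MvPolynomial (Fin 5) k ⧸ Ideal.span {G})) [Q.IsPrime] (hc : Ideal.Quotient.mk (Ideal.span {G}) (X 2) ∉ Q) :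
    IsRegularLocalRing (Localization.AtPrime Q) := by
  have hP : (Q.comap (Ideal.Quotient.mk (Ideal.span {G}))).IsPrime := Ideal.comap_isPrime _ _
  refine HypersurfaceRegular.stub_hypersurfaceRegularOfPderiv k 5 G (Fin.last 4) Q ?_
  rw [pderiv_last_uChart k e G hG]
  intro hB
  have hGQ : G ∈ Q.comap (Ideal.Quotient.mk (Ideal.span {G})) := by
    rw [Ideal.mem_comap, Ideal.Quotient.eq_zero_iff_mem.mpr (Ideal.mem_span_singleton_self G)]
    exact Q.zero_mem
  have hce : (X 2 : MvPolynomial (Fin 5) k) ^ e ∈ Q.comap (Ideal.Quotient.mk (Ideal.span {G})) := by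
    have h1 : (X 2 : MvPolynomial (Fin 5) k) ^ e = rename (Fin.castSucc : Fin 4 → Fin 5) (X 0 ^ 2 - X 1 ^ 3 : MvPolynomial (Fin 4) k) * X (Fin.last 4) - G := by
      rw [hG, rename_Me]; ring
    rw [h1]
    exact Ideal.sub_mem _ (Ideal.mul_mem_right _ _ hB) hGQ
  exact hc (Ideal.mem_comap.mp (hP.mem_of_pow_mem e hce))

end Summit.ResolutionOfSingularities.ResolutionOfSingularities.Theorems.FInjectiveMacaulayfication.OmegaCuspPencilInput

end
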